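import Mathlib.Analysis.Calculus.FDeriv.Symmetric
import Mathlib.Analysis.Calculus.ContDiff.Basic
import Mathlib.GroupTheory.Perm.Sign
import HarnessLib

/-!
# Symmetry of higher Fréchet derivatives of `C^n` maps

For a map `f : E → F` between normed spaces over `ℝ` or `ℂ` which is `C^n` at a point `x`, the
`m`-th Fréchet derivative `D^m f(x)` (Mathlib's `iteratedFDeriv 𝕜 m f x`, a continuous `m`-linear
map) is a *symmetric* multilinear map for every `m ≤ n`:

  `D^m f(x)(v_{σ(1)}, …, v_{σ(m)}) = D^m f(x)(v_1, …, v_m)` for every permutation `σ`.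

This is the classical theorem of H. A. Schwarz / Clairaut on the equality of mixed partials, in
its higher-order Banach-space form (Dieudonné, *Foundations of Modern Analysis*, Ch. VIII §12,
(8.12.4); Cartan, *Differential Calculus*, Ch. 1 §5). Mathlib has the order-two statement
(`ContDiffAt.isSymmSndFDerivAt`) and the all-orders statement for *analytic* maps
(`ContDiffAt.iteratedFDeriv_comp_perm`, hypothesis `ContDiffAt 𝕜 ω f x`); the finite-smoothness
all-orders statement proved here (`iteratedFDeriv_comp_perm_of_contDiffAt`) is the one needed for
Taylor polynomials of `C^n` maps (e.g. the `T_φ`-seminorm estimates of Bauerschmidt–Brydges–Slade,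
Lemma 7.5.1/7.5.3, where smoothness but not analyticity in the field is available).

Proof: induction on `m`. A transposition of two slots different from the first is handled by
writing `D^{m+2} f(x)(v) = ∂_{v₀}(y ↦ D^{m+1} f(y)(tail v))(x)` and using that `D^{m+1} f(y)` is,
for `y` near `x`, invariant under the transposition (induction hypothesis at nearby points), so the
directional derivative is too; the transposition of the first two slots is the symmetry
of the second derivative of `D^m f`; these transpositions generate the symmetric group.

## References

* J. Dieudonné, *Foundations of Modern Analysis*, Academic Press 1960, Ch. VIII §12, (8.12.4). [Dieudonne1960]
* H. Cartan, *Differential Calculus*, Hermann/Houghton Mifflin 1971, Ch. 1 §5. [Cartan1971DifferentialCalculus]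
-/

noncomputable section

namespace Literature.Analysis.Calculus

open Function Filter
open scoped Topology ContDiff

variable {𝕜 : Type*} [NontriviallyNormedField 𝕜]
  {E F : Type*} [NormedAddCommGroup E] [NormedSpace 𝕜 E] [NormedAddCommGroup F] [NormedSpace 𝕜 F]

/-- Re-indexing lemma: dropping the first slot of `v ∘ swap (a+1) (b+1)` gives
`(tail v) ∘ swap a b`. [folklore] -/
theorem tail_comp_swap_succ {α : Type*} {m : ℕ} (v : Fin (m + 1) → α) (a b : Fin m) :
    Fin.tail (v ∘ Equiv.swap a.succ b.succ) = Fin.tail v ∘ Equiv.swap a b := by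
  funext i
  simp only [Fin.tail, comp_apply]
  rw [← (Fin.succ_injective m).map_swap a b i]

/-- **Transpositions away from the first slot.** If `D^{m+1} f` is differentiable at `x` and, at
every point near `x`, invariant under the transposition `swap a b` of its slots, then the
`(m+2)`-nd derivative at `x` is invariant under `swap (a+1) (b+1)`: indeed
`D^{m+2}f(x)(v) = ∂_{v₀} (y ↦ D^{m+1}f(y)(tail v))` and the two directional derivatives are
derivatives of functions that agree near `x`. [folklore] -/
theorem iteratedFDeriv_comp_swap_succ_of_eventually {f : E → F} {x : E} {m : ℕ} {a b : Fin (m + 1)}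
    (hd : DifferentiableAt 𝕜 (iteratedFDeriv 𝕜 (m + 1) f) x)
    (h : ∀ᶠ y in 𝓝 x, ∀ w : Fin (m + 1) → E,
      iteratedFDeriv 𝕜 (m + 1) f y (w ∘ Equiv.swap a b) = iteratedFDeriv 𝕜 (m + 1) f y w)
    (v : Fin (m + 2) → E) :
    iteratedFDeriv 𝕜 (m + 2) f x (v ∘ Equiv.swap a.succ b.succ) = iteratedFDeriv 𝕜 (m + 2) f x v := by
  -- the first slot of `v ∘ swap (a+1) (b+1)` is `v 0` (`comp_apply` + `Equiv.swap_apply_of_ne_of_ne`)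
  rw [iteratedFDeriv_succ_apply_left, iteratedFDeriv_succ_apply_left, comp_apply,
    Equiv.swap_apply_of_ne_of_ne (Fin.succ_ne_zero a).symm (Fin.succ_ne_zero b).symm,
    tail_comp_swap_succ, ← fderiv_continuousMultilinear_apply_const_apply hd (Fin.tail v ∘ Equiv.swap a b) (v 0),
    ← fderiv_continuousMultilinear_apply_const_apply hd (Fin.tail v) (v 0)]
  have hEq : (fun y => iteratedFDeriv 𝕜 (m + 1) f y (Fin.tail v ∘ Equiv.swap a b)) =ᶠ[𝓝 x]
      (fun y => iteratedFDeriv 𝕜 (m + 1) f y (Fin.tail v)) := by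
    filter_upwards [h] with y hy
    exact hy _
  rw [hEq.fderiv_eq]

/-- `D^{m+2} f(x)(a, b, T) = (D²(D^m f)(x)(a)(b))(T)`: the first two slots of an iterated
derivative form a second derivative of a lower one (for `f` of class `C^{m+2}` at `x`). [folklore] -/
theorem iteratedFDeriv_cons_cons_eq_fderiv_fderiv {f : E → F} {x : E} {m : ℕ} {n : WithTop ℕ∞}
    (hf : ContDiffAt 𝕜 n f x) (hm : (m : WithTop ℕ∞) + 2 ≤ n) (a b : E) (T : Fin m → E) :
    iteratedFDeriv 𝕜 (m + 2) f x (Fin.cons a (Fin.cons b T)) =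
      (fderiv 𝕜 (fderiv 𝕜 (iteratedFDeriv 𝕜 m f)) x a b) T := by
  have hg : ContDiffAt 𝕜 2 (iteratedFDeriv 𝕜 m f) x :=
    hf.iteratedFDeriv_right (by rwa [add_comm] at hm)
  have hdg : DifferentiableAt 𝕜 (fderiv 𝕜 (iteratedFDeriv 𝕜 m f)) x :=
    (hg.fderiv_right (m := 1) le_rfl).differentiableAt one_ne_zero
  have hlt : ((m + 1 : ℕ) : WithTop ℕ∞) < n :=
    lt_of_lt_of_le (by exact_mod_cast Nat.lt_succ_self (m + 1)) hm
  have hd1 : DifferentiableAt 𝕜 (iteratedFDeriv 𝕜 (m + 1) f) x :=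
    hf.differentiableAt_iteratedFDeriv hlt
  rw [iteratedFDeriv_succ_apply_left, Fin.cons_zero, Fin.tail_cons,
    ← fderiv_continuousMultilinear_apply_const_apply hd1 (Fin.cons b T) a]
  have hfun : (fun w => iteratedFDeriv 𝕜 (m + 1) f w (Fin.cons b T)) =
      fun w => (fderiv 𝕜 (iteratedFDeriv 𝕜 m f) w b) T := by
    funext w
    rw [iteratedFDeriv_succ_apply_left, Fin.cons_zero, Fin.tail_cons]
  rw [hfun, fderiv_continuousMultilinear_apply_const_apply (hdg.clm_apply
    (differentiableAt_const b)) T a, fderiv_clm_apply hdg (differentiableAt_const b)]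
  simp

/-- Splitting off the first two slots: `v = (v₀, v₁, tail (tail v))`. [folklore] -/
theorem eq_cons_cons_tail_tail {α : Type*} {m : ℕ} (v : Fin (m + 2) → α) :
    v = Fin.cons (v 0) (Fin.cons (v 1) (Fin.tail (Fin.tail v))) := by
  conv_lhs => rw [← Fin.cons_self_tail v, ← Fin.cons_self_tail (Fin.tail v)]
  rfl

/-- After the transposition of the first two slots: `v ∘ swap 0 1 = (v₁, v₀, tail (tail v))`. [folklore] -/
theorem comp_swap_zero_one_eq_cons_cons {α : Type*} {m : ℕ} (v : Fin (m + 2) → α) :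
    v ∘ Equiv.swap (0 : Fin (m + 2)) 1 = Fin.cons (v 1) (Fin.cons (v 0) (Fin.tail (Fin.tail v))) := by
  funext i
  refine Fin.cases ?_ (fun j => ?_) i
  · simp
  · refine Fin.cases ?_ (fun k => ?_) j
    · rw [Fin.cons_succ, Fin.cons_zero, comp_apply, Fin.succ_zero_eq_one, Equiv.swap_apply_right]
    · simp only [comp_apply, Fin.cons_succ, Fin.tail]
      rw [Equiv.swap_apply_of_ne_of_ne (Fin.succ_ne_zero _) (by simp [Fin.ext_iff])]

/-- **Transposition of the first two slots**: `D^{m+2}f(x)(v₁, v₀, v₂, …) = D^{m+2}f(x)(v₀, v₁, v₂, …)`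
for `f` of class `C^{m+2}` at `x` over `ℝ` or `ℂ` — the symmetry of the second derivative of
`D^m f` (Mathlib `ContDiffAt.isSymmSndFDerivAt`). [folklore] -/
theorem iteratedFDeriv_comp_swap_zero_one [IsRCLikeNormedField 𝕜] {f : E → F} {x : E} {m : ℕ}
    {n : WithTop ℕ∞} (hf : ContDiffAt 𝕜 n f x) (hm : (m : WithTop ℕ∞) + 2 ≤ n)
    (v : Fin (m + 2) → E) :
    iteratedFDeriv 𝕜 (m + 2) f x (v ∘ Equiv.swap 0 1) = iteratedFDeriv 𝕜 (m + 2) f x v := by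
  have hg : ContDiffAt 𝕜 2 (iteratedFDeriv 𝕜 m f) x :=
    hf.iteratedFDeriv_right (by rwa [add_comm] at hm)
  have hsymm : IsSymmSndFDerivAt 𝕜 (iteratedFDeriv 𝕜 m f) x := hg.isSymmSndFDerivAt (by simp)
  rw [comp_swap_zero_one_eq_cons_cons v]
  conv_rhs => rw [eq_cons_cons_tail_tail v]
  rw [iteratedFDeriv_cons_cons_eq_fderiv_fderiv hf hm, iteratedFDeriv_cons_cons_eq_fderiv_fderiv hf hm,
    hsymm.eq]

/-- **Symmetry of higher derivatives (Schwarz–Clairaut, all orders).** If `f` is `C^n` at `x`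
over `ℝ` or `ℂ`, then for every `m ≤ n` the `m`-th Fréchet derivative `D^m f(x)` is a symmetric
`m`-linear map: `D^m f(x)(v ∘ σ) = D^m f(x)(v)` for every permutation `σ` of the slots.
[cite: Dieudonne1960, Ch. VIII §12 (8.12.4)] -/
theorem iteratedFDeriv_comp_perm_of_contDiffAt [IsRCLikeNormedField 𝕜] {f : E → F} {n : ℕ} :
    ∀ (m : ℕ), m ≤ n → ∀ {x : E}, ContDiffAt 𝕜 n f x →
      ∀ (v : Fin m → E) (σ : Equiv.Perm (Fin m)),
        iteratedFDeriv 𝕜 m f x (v ∘ σ) = iteratedFDeriv 𝕜 m f x v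
  | 0, _, x, _, v, σ => by
      congr 1
      funext i
      exact i.elim0
  | 1, _, x, _, v, σ => by
      congr 1
      funext i
      simp only [comp_apply, Subsingleton.elim (σ i) i]
  | m + 2, hm, x, hf, v, σ => by
      -- (A) transpositions of two slots different from the first one
      have hA : ∀ (a' b' : Fin (m + 1)) (w : Fin (m + 2) → E),
          iteratedFDeriv 𝕜 (m + 2) f x (w ∘ Equiv.swap a'.succ b'.succ) =
            iteratedFDeriv 𝕜 (m + 2) f x w := by
        intro a' b' w
        apply iteratedFDeriv_comp_swap_succ_of_eventually
          (hf.differentiableAt_iteratedFDeriv (by exact_mod_cast (show m + 1 < n by omega)))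
        have hev : ∀ᶠ y in 𝓝 x, ContDiffAt 𝕜 (n : WithTop ℕ∞) f y := hf.eventually (by simp)
        filter_upwards [hev] with y hy
        intro w'
        exact iteratedFDeriv_comp_perm_of_contDiffAt (m + 1) (by omega) hy w' (Equiv.swap a' b')
      -- (C) the transposition of the first two slots
      have hC : ∀ w : Fin (m + 2) → E,
          iteratedFDeriv 𝕜 (m + 2) f x (w ∘ Equiv.swap 0 1) = iteratedFDeriv 𝕜 (m + 2) f x w :=
        fun w => iteratedFDeriv_comp_swap_zero_one hf (by exact_mod_cast hm) w
      -- (B) transpositions involving the first slot: `swap 0 (b+1) = swap 1 (b+1) * swap 0 1 * swap 1 (b+1)`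
      have hA1 : ∀ (b' : Fin (m + 1)) (w : Fin (m + 2) → E),
          iteratedFDeriv 𝕜 (m + 2) f x (w ∘ Equiv.swap 1 b'.succ) = iteratedFDeriv 𝕜 (m + 2) f x w := by
        intro b' w
        have h := hA 0 b' w
        rwa [Fin.succ_zero_eq_one] at h
      have hB : ∀ (b : Fin (m + 2)), b ≠ 0 → ∀ w : Fin (m + 2) → E,
          iteratedFDeriv 𝕜 (m + 2) f x (w ∘ Equiv.swap 0 b) = iteratedFDeriv 𝕜 (m + 2) f x w := by
        intro b hb w
        obtain ⟨b', rfl⟩ := Fin.exists_succ_eq.2 hb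
        by_cases hb1 : b' = 0
        · subst hb1
          rw [Fin.succ_zero_eq_one]
          exact hC w
        · have hne : (1 : Fin (m + 2)) ≠ b'.succ := by
            rw [← Fin.succ_zero_eq_one]
            exact fun h => hb1 (Fin.succ_injective _ h).symm
          have hdec : Equiv.swap (0 : Fin (m + 2)) b'.succ =
              Equiv.swap 1 b'.succ * Equiv.swap 0 1 * Equiv.swap 1 b'.succ := by
            rw [Equiv.swap_mul_swap_mul_swap (Fin.zero_ne_one) (Fin.succ_ne_zero b').symm,
              Equiv.swap_comm]
          calc iteratedFDeriv 𝕜 (m + 2) f x (w ∘ Equiv.swap 0 b'.succ)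
              = iteratedFDeriv 𝕜 (m + 2) f x
                  (((w ∘ Equiv.swap 1 b'.succ) ∘ Equiv.swap 0 1) ∘ Equiv.swap 1 b'.succ) := by
                rw [hdec]; rfl
            _ = iteratedFDeriv 𝕜 (m + 2) f x ((w ∘ Equiv.swap 1 b'.succ) ∘ Equiv.swap 0 1) := hA1 b' _
            _ = iteratedFDeriv 𝕜 (m + 2) f x (w ∘ Equiv.swap 1 b'.succ) := hC _
            _ = iteratedFDeriv 𝕜 (m + 2) f x w := hA1 b' w
      -- every transposition
      have hswap : ∀ (a b : Fin (m + 2)), a ≠ b → ∀ w : Fin (m + 2) → E,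
          iteratedFDeriv 𝕜 (m + 2) f x (w ∘ Equiv.swap a b) = iteratedFDeriv 𝕜 (m + 2) f x w := by
        intro a b hab w
        rcases eq_or_ne a 0 with rfl | ha
        · exact hB b hab.symm w
        rcases eq_or_ne b 0 with rfl | hb
        · rw [Equiv.swap_comm]; exact hB a ha w
        obtain ⟨a', rfl⟩ := Fin.exists_succ_eq.2 ha
        obtain ⟨b', rfl⟩ := Fin.exists_succ_eq.2 hb
        exact hA a' b' w
      -- transpositions generate the symmetric group
      induction σ using Equiv.Perm.swap_induction_on generalizing v with
      | one => rfl
      | swap_mul τ a b hab ih =>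
          rw [Equiv.Perm.coe_mul, ← comp_assoc, ih (v ∘ Equiv.swap a b)]
          exact hswap a b hab v

variable [IsRCLikeNormedField 𝕜]

/-- **Symmetry of higher derivatives**, general smoothness exponent (`n : WithTop ℕ∞`, so also
`C^∞` and analytic maps): `D^m f(x)(v ∘ σ) = D^m f(x)(v)` for `m ≤ n`.
[cite: Dieudonne1960, Ch. VIII §12 (8.12.4)] -/
theorem iteratedFDeriv_comp_perm_of_le {f : E → F} {x : E} {n : WithTop ℕ∞} (hf : ContDiffAt 𝕜 n f x)
    {m : ℕ} (hm : (m : WithTop ℕ∞) ≤ n) (v : Fin m → E) (σ : Equiv.Perm (Fin m)) :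
    iteratedFDeriv 𝕜 m f x (v ∘ σ) = iteratedFDeriv 𝕜 m f x v :=
  iteratedFDeriv_comp_perm_of_contDiffAt m le_rfl (hf.of_le hm) v σ

/-- Pointwise-argument form: `D^m f(x)(fun i => v (σ i)) = D^m f(x)(v)`. [cite: Dieudonne1960, Ch. VIII §12 (8.12.4)] -/
theorem iteratedFDeriv_apply_perm_of_le {f : E → F} {x : E} {n : WithTop ℕ∞} (hf : ContDiffAt 𝕜 n f x)
    {m : ℕ} (hm : (m : WithTop ℕ∞) ≤ n) (v : Fin m → E) (σ : Equiv.Perm (Fin m)) :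
    iteratedFDeriv 𝕜 m f x (fun i => v (σ i)) = iteratedFDeriv 𝕜 m f x v :=
  iteratedFDeriv_comp_perm_of_le hf hm v σ

/-- `domDomCongr` form: re-indexing the slots of `D^m f(x)` by a permutation does not change it.
[cite: Dieudonne1960, Ch. VIII §12 (8.12.4)] -/
theorem domDomCongr_iteratedFDeriv_of_le {f : E → F} {x : E} {n : WithTop ℕ∞} (hf : ContDiffAt 𝕜 n f x)
    {m : ℕ} (hm : (m : WithTop ℕ∞) ≤ n) (σ : Equiv.Perm (Fin m)) :
    (iteratedFDeriv 𝕜 m f x).domDomCongr σ = iteratedFDeriv 𝕜 m f x := by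
  ext v
  exact iteratedFDeriv_apply_perm_of_le hf hm v σ

/-- Global version: for `f` of class `C^n` and `m ≤ n`, every `D^m f(x)` is symmetric.
[cite: Dieudonne1960, Ch. VIII §12 (8.12.4)] -/
theorem iteratedFDeriv_comp_perm_of_contDiff {f : E → F} {n : WithTop ℕ∞} (hf : ContDiff 𝕜 n f)
    {m : ℕ} (hm : (m : WithTop ℕ∞) ≤ n) (x : E) (v : Fin m → E) (σ : Equiv.Perm (Fin m)) :
    iteratedFDeriv 𝕜 m f x (v ∘ σ) = iteratedFDeriv 𝕜 m f x v :=
  iteratedFDeriv_comp_perm_of_le hf.contDiffAt hm v σ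

/-- **Summing over all slot permutations** of a symmetric derivative just multiplies by `m!`:
`∑_σ D^m f(x)(v ∘ σ) = m! • D^m f(x)(v)` — the identity behind "the `m`-th derivative at `0` of
`φ ↦ D^m f(0)(φ,…,φ)/m!` is `D^m f(0)`" (Mathlib `ContinuousMultilinearMap.iteratedFDeriv_comp_diagonal`).
[folklore] -/
theorem sum_perm_iteratedFDeriv_apply {f : E → F} {x : E} {n : WithTop ℕ∞} (hf : ContDiffAt 𝕜 n f x)
    {m : ℕ} (hm : (m : WithTop ℕ∞) ≤ n) (v : Fin m → E) :
    ∑ σ : Equiv.Perm (Fin m), iteratedFDeriv 𝕜 m f x (fun i => v (σ i)) =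
      (m.factorial : 𝕜) • iteratedFDeriv 𝕜 m f x v := by
  simp only [iteratedFDeriv_apply_perm_of_le hf hm, Finset.sum_const, Finset.card_univ,
    Fintype.card_perm, Fintype.card_fin, Nat.cast_smul_eq_nsmul]

/-- **Derivatives of the diagonal restriction of a derivative.** For `f` of class `C^n` at `x₀`
and `m ≤ n`, the `m`-th derivative (anywhere, in particular at `0`) of the homogeneous polynomial
`φ ↦ D^m f(x₀)(φ, …, φ)` is the constant symmetric map `m! • D^m f(x₀)`. [folklore] -/
theorem iteratedFDeriv_diag_iteratedFDeriv {f : E → F} {x₀ : E} {n : WithTop ℕ∞} (hf : ContDiffAt 𝕜 n f x₀)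
    {m : ℕ} (hm : (m : WithTop ℕ∞) ≤ n) (x : E) :
    iteratedFDeriv 𝕜 m (fun φ : E => iteratedFDeriv 𝕜 m f x₀ (fun _ => φ)) x =
      (m.factorial : 𝕜) • iteratedFDeriv 𝕜 m f x₀ := by
  ext v
  rw [ContinuousMultilinearMap.iteratedFDeriv_comp_diagonal, sum_perm_iteratedFDeriv_apply hf hm]
  rfl

end Literature.Analysis.Calculus

end
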